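import Summits.ResolutionOfSingularities.ResolutionOfSingularities.Theorems.FrobeniusLadderFInjectiveMacaulayficationFHalfRowOfTwoStoreysPushforward
import Literature.AlgebraicGeometry.Resolution.IdealSheafLemmas
import HarnessLib

/-!
# (W-TD) two-storey glue, chart calculus for the pushed-forward centre: intersections, restriction to a second chart, FULL-ness off a nuisance support
# (crux `FInjectiveMacaulayfication` stmt-ResolutionOfSingularities-15315, chain w45a; res-L1-w45a-plan-1 RULINGS R21.26–R21.30 «row #8 = storey 1 Σ_D^{𝔪K} + ONE global blowing up
# of X₁ along J; stub-1: the `ideal_map` bookkeeping + assembly»; seat res-L1-w45a-stub-1 g13, DESIGN FINDING 21:24Z (F1) «J⁺ := (K′~).map ι₂₇₇ ⊓ (M₄~).map ι₂₇₅ ⊓ (M₅~).map ι₁₁ —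
# no gluing, no saturation»; GENERIC part, sequel of ✓ p668755 `…FHalfRowOfTwoStoreysPushforward`)

[OURS · L1 W4.5a] Support file (`--supports stmt-ResolutionOfSingularities-15315 --as helper`); def-free; UNCONDITIONAL; no named fact; NOT a statement of any manuscript.
Nothing of the crux is proved. AI-written (AI review is weaker than expert review).

* §1 `comap_inf_of_isOpenImmersion` — restriction to an open commutes with intersections of ideal sheaves (affine-locally `ideal_inf`); `comap_map_eq_top_of_disjoint` — the
  largest extension `K.map ι` restricts to `⊤` on a chart `ι′` whose range misses `ι(Supp K)` (its support is the closure, and an open set missing a set misses its closure).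
* §2 ★ `fullCl_of_isBlowup_inf_off_support` — a blowing up along `A ⊓ N` is, over the complement of `Supp N`, a blowing up along `A`; so if every blowing up along `A` is FULL
  at every point, every blowing up along `A ⊓ N` is FULL at its points off `Supp N` (`IsBlowup.restrict`, uniqueness, stalks along open immersions).
* §3 ★★ `comap_map_eq_ofIdealTop_of_charts` — THE TWO-CHART FORMULA: `ι : X → Y`, `ι′ : X′ → Y` open immersions (`ι` quasi-compact, `X′` affine) whose overlap is an affine
  chart `j : W → X`, `j′ : W → X′` (`j ≫ ι = j′ ≫ ι′`, `j(W) = ι⁻¹ ι′(X′)`); then for every ideal sheaf `K` on `X`: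
  `(K.map ι)|_{X′} = ((K|_W)(W) ∩ Γ(X′))~`, i.e. `((K.map ι).comap ι′) = ofIdealTop (((K.comap j).ideal ⊤).comap j′♯)` — Mathlib's `ideal_map` / `ideal_comap_of_isOpenImmersion` plus
  an `appLE` diagram chase; `…_ofIdealTop_of_charts` (`X` affine, `K = K₀~`: the ideal is `(K₀·Γ(W)) ∩ Γ(X′)`) and `comap_map_idealSheaf_of_charts` (everything `Spec`: for
  `τ : B → C`, `τ′ : B′ → C` the overlap ring maps, `((K₀~).map ι).comap ι′ = ((K₀·C) ∩ B′)~ = (K₀.map τ).comap τ′ ~`).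
[cite: GortzWedhorn2020, Prop. 13.91 and (13.19)] [cite: StacksProject, Tag 01HQ and Tag 080B]
-/

-- single-problem summit: the doubled namespace component is forced
set_option linter.dupNamespace false

noncomputable section

namespace Summit.ResolutionOfSingularities.ResolutionOfSingularities.Theorems.FInjectiveMacaulayfication.FHalfRowOfTwoStoreys

open CategoryTheory CategoryTheory.Limits AlgebraicGeometry TopologicalSpace IsLocalRing
open Literature.AlgebraicGeometry.Resolution
open Summit.ResolutionOfSingularities.ResolutionOfSingularities.Theorems.FInjectiveMacaulayfication
open SliceableCentre GermOfGlobalBlowup Scheme.IdealSheafData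

universe u

/-! ## §1 Restriction of intersections; the largest extension is trivial on a chart missing the support -/

/-- Restriction to an open subscheme (pull-back along an open immersion) commutes with intersections of ideal sheaves. [folklore] -/
theorem comap_inf_of_isOpenImmersion {U Y : Scheme.{u}} (ι : U ⟶ Y) [IsOpenImmersion ι] (I J : Y.IdealSheafData) :
    (I ⊓ J).comap ι = I.comap ι ⊓ J.comap ι := by
  refine Scheme.IdealSheafData.ext (funext fun W => ?_)
  rw [ideal_inf, Pi.inf_apply, ideal_comap_of_isOpenImmersion, ideal_comap_of_isOpenImmersion, ideal_comap_of_isOpenImmersion,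
    ideal_inf, Pi.inf_apply, Ideal.comap_inf]

/-- The largest extension `K.map ι` is the unit ideal sheaf on every open `ι′ : U′ → Y` whose range misses `ι(Supp K)` (its support is the closure of `ι(Supp K)`, and an open
set disjoint from a set is disjoint from its closure). [folklore] -/
theorem comap_map_eq_top_of_disjoint {U U' Y : Scheme.{u}} (ι : U ⟶ Y) [QuasiCompact ι] (ι' : U' ⟶ Y) [IsOpenImmersion ι'] (K : U.IdealSheafData)
    (h : Disjoint ((fun u : U => ι.base u) '' (K.support : Set U)) (Set.range fun u' : U' => ι'.base u')) :
    (K.map ι).comap ι' = ⊤ := by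
  rw [← support_eq_bot_iff, support_comap]
  ext u'
  simp only [Closeds.coe_preimage, Set.mem_preimage, Closeds.coe_bot, Set.mem_empty_iff_false, iff_false]
  intro hu'
  have hcl : ι'.base u' ∈ closure ((fun u : U => ι.base u) '' (K.support : Set U)) := by
    have := hu'
    rw [support_map] at this
    exact this
  have hd := h.closure_left ι'.isOpenEmbedding.isOpen_range
  exact Set.disjoint_left.mp hd hcl ⟨u', rfl⟩

/-! ## §2 FULL-ness of the blowing ups along `A ⊓ N` off `Supp N` -/

/-- ★ **Off `Supp N`, a blowing up along `A ⊓ N` is a blowing up along `A`.** If every blowing up of `V` along `A` is FULL at every point, then every blowing up of `V` along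
`A ⊓ N` is FULL at its points lying over the complement of `Supp N`. [cite: GortzWedhorn2020, Prop. 13.91 (2) and (13.19)] -/
theorem fullCl_of_isBlowup_inf_off_support (p : ℕ) {V : Scheme.{0}} (A N : V.IdealSheafData)
    (hA : ∀ (W' : Scheme.{0}) (ρ' : W' ⟶ V), IsBlowup ρ' A → ∀ w' : W', FullCl p (W'.presheaf.stalk w'))
    {W : Scheme.{0}} {ρ : W ⟶ V} (hρ : IsBlowup ρ (A ⊓ N)) (w : W) (hw : ρ.base w ∉ (N.support : Set V)) :
    FullCl p (W.presheaf.stalk w) := by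
  let O : V.Opens := ⟨(N.support : Set V)ᶜ, N.support.isClosed.isOpen_compl⟩
  -- over `O` the centre `A ⊓ N` is `A`
  have hN : N.comap O.ι = ⊤ := by
    rw [← support_eq_bot_iff, support_comap]
    ext t
    simp only [Closeds.coe_preimage, Set.mem_preimage, Closeds.coe_bot, Set.mem_empty_iff_false, iff_false]
    exact t.2
  have hres : IsBlowup (ρ ∣_ O) (A.comap O.ι) := by
    have := hρ.restrict O
    rwa [comap_inf_of_isOpenImmersion, hN, inf_top_eq] at this
  -- some blowing up of `V` along `A`, restricted over `O`
  obtain ⟨W', ρ', hρ'⟩ := exists_isBlowup V A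
  have hres' : IsBlowup (ρ' ∣_ O) (A.comap O.ι) := hρ'.restrict O
  obtain ⟨e, -, -⟩ := hres.unique hres'
  have hwO : w ∈ ρ ⁻¹ᵁ O := hw
  have h1 := hA W' ρ' hρ' ((ρ' ⁻¹ᵁ O).ι.base (e.hom.base ⟨w, hwO⟩))
  have h2 := FTemkinClosedPoints.fullCl_of_isIso_stalkMap' p (ρ' ⁻¹ᵁ O).ι (e.hom.base ⟨w, hwO⟩) h1
  have h3 := FTemkinClosedPoints.fullCl_of_isIso_stalkMap' p e.hom ⟨w, hwO⟩ h2
  exact FTemkinClosedPoints.fullCl_of_isIso_stalkMap p (ρ ⁻¹ᵁ O).ι ⟨w, hwO⟩ h3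

/-- Hence the chart input of ✓ `fullCl_of_isBlowup_of_chart` for a centre whose restriction to the chart is `A ⊓ N`: FULL over `T := (Supp N)ᶜ`. [plumbing] -/
theorem forall_isBlowup_fullCl_over_compl_support (p : ℕ) {V : Scheme.{0}} (A N : V.IdealSheafData)
    (hA : ∀ (W' : Scheme.{0}) (ρ' : W' ⟶ V), IsBlowup ρ' A → ∀ w' : W', FullCl p (W'.presheaf.stalk w')) :
    ∀ (W : Scheme.{0}) (ρ : W ⟶ V), IsBlowup ρ (A ⊓ N) → ∀ w : W, ρ.base w ∈ (N.support : Set V)ᶜ → FullCl p (W.presheaf.stalk w) :=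
  fun _ _ hρ w hw => fullCl_of_isBlowup_inf_off_support p A N hA hρ w hw

/-! ## §3 ★★ The two-chart formula for the largest extension -/

/-- Plumbing: the ideals of an ideal sheaf at two EQUAL affine opens agree through the restriction map `homOfLE`. [plumbing] -/
theorem ideal_comap_presheaf_map_of_eq {Y : Scheme.{u}} (I : Y.IdealSheafData) {V₁ V₂ : Y.Opens} (h : V₁ = V₂)
    (h₁ : IsAffineOpen V₁) (h₂ : IsAffineOpen V₂) :
    (I.ideal ⟨V₁, h₁⟩).comap (Y.presheaf.map (homOfLE h.le).op).hom = I.ideal ⟨V₂, h₂⟩ := by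
  subst h
  rw [show homOfLE (le_refl V₁) = 𝟙 _ from Subsingleton.elim _ _, op_id, Y.presheaf.map_id, CommRingCat.hom_id]
  exact Ideal.comap_id _

/-- ★★ **THE TWO-CHART FORMULA.** `ι : X → Y`, `ι′ : X′ → Y` open immersions (`ι` quasi-compact, `X′` affine) with an affine overlap chart `j : W → X`, `j′ : W → X′`
(`j` an open immersion onto `ι⁻¹ ι′(X′)`, `j ≫ ι = j′ ≫ ι′`). Then the largest extension of an ideal sheaf `K` on `X`, restricted to `X′`, is the ideal sheaf of the CONTRACTION
to `Γ(X′)` of the ideal `(K|_W)(W)`: `(K.map ι).comap ι′ = ((K.comap j)(⊤) ∩ Γ(X′))~`. [cite: GortzWedhorn2020, Prop. 13.91 (2)] [cite: StacksProject, Tag 01HQ] -/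
theorem comap_map_eq_ofIdealTop_of_charts {Y X X' W : Scheme.{u}} [IsAffine X'] [IsAffine W]
    (ι : X ⟶ Y) [IsOpenImmersion ι] [QuasiCompact ι] (ι' : X' ⟶ Y) [IsOpenImmersion ι']
    (j : W ⟶ X) [IsOpenImmersion j] (j' : W ⟶ X') (hcomm : j ≫ ι = j' ≫ ι')
    (hj : j.opensRange = ι ⁻¹ᵁ ι'.opensRange) (K : X.IdealSheafData) :
    (K.map ι).comap ι' = ofIdealTop (((K.comap j).ideal ⟨⊤, isAffineOpen_top W⟩).comap j'.appTop.hom) := by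
  -- the overlap as an open of `X` is `j(W)`
  have hW : j ''ᵁ ⊤ = ι ⁻¹ᵁ (ι' ''ᵁ ⊤) := by
    rw [Scheme.Hom.image_top_eq_opensRange, Scheme.Hom.image_top_eq_opensRange, hj]
  have hWaff : IsAffineOpen (j ''ᵁ (⊤ : W.Opens)) := (isAffineOpen_top W).image_of_isOpenImmersion j
  have H : IsAffineOpen (ι ⁻¹ᵁ (ι' ''ᵁ (⊤ : X'.Opens))) := hW ▸ hWaff
  -- the ideal of `K` on `j(W)` through `Γ(W, ⊤)`
  have hKj : K.ideal ⟨j ''ᵁ ⊤, hWaff⟩ = ((K.comap j).ideal ⟨⊤, isAffineOpen_top W⟩).comap (j.appIso ⊤).hom.hom := by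
    have h1 : (K.comap j).ideal ⟨⊤, isAffineOpen_top W⟩ = (K.ideal ⟨j ''ᵁ ⊤, hWaff⟩).comap (j.appIso ⊤).inv.hom :=
      ideal_comap_of_isOpenImmersion K j ⟨⊤, isAffineOpen_top W⟩
    rw [h1, Ideal.comap_comap, ← CommRingCat.hom_comp, Iso.hom_inv_id, CommRingCat.hom_id, Ideal.comap_id]
  -- compare the top ideals on the affine scheme `X′`
  refine ext_of_isAffine ?_
  rw [Literature.AlgebraicGeometry.Resolution.ideal_ofIdealTop_top]
  have h2 : ((K.map ι).comap ι').ideal ⟨⊤, isAffineOpen_top X'⟩ =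
      ((K.map ι).ideal ⟨ι' ''ᵁ ⊤, (isAffineOpen_top X').image_of_isOpenImmersion ι'⟩).comap (ι'.appIso ⊤).inv.hom :=
    ideal_comap_of_isOpenImmersion _ ι' ⟨⊤, isAffineOpen_top X'⟩
  rw [h2, ideal_map K ι ⟨ι' ''ᵁ ⊤, (isAffineOpen_top X').image_of_isOpenImmersion ι'⟩ H]
  change ((K.ideal ⟨ι ⁻¹ᵁ (ι' ''ᵁ ⊤), H⟩).comap (ι.app (ι' ''ᵁ ⊤)).hom).comap (ι'.appIso ⊤).inv.hom = _
  rw [← ideal_comap_presheaf_map_of_eq K hW hWaff H, hKj]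
  simp only [Ideal.comap_comap, ← CommRingCat.hom_comp]
  -- the ring-map identity: `(ι′.appIso ⊤)⁻¹ ≫ ι♯ ≫ res ≫ (j.appIso ⊤) = j′♯`
  have key : (ι'.appIso ⊤).inv ≫ ι.app (ι' ''ᵁ ⊤) ≫ X.presheaf.map (homOfLE hW.le).op ≫ (j.appIso ⊤).hom = j'.appTop := by
    rw [Iso.inv_comp_eq, Scheme.Hom.appIso_hom', Scheme.Hom.appIso_hom', Scheme.Hom.app_eq_appLE, ← Category.assoc, Scheme.Hom.appLE_map,
      Scheme.Hom.appLE_comp_appLE]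
    have hR : j'.appTop = j'.appLE ⊤ ⊤ le_top := j'.app_eq_appLE
    rw [hR, Scheme.Hom.appLE_comp_appLE]
    -- equal morphisms have equal `appLE` (cf. `WildQuotientResolution.S1.BlowupCharts.appLE_congr_of_eq`; inlined to keep the import light)
    have hcongr : ∀ {φ ψ : W ⟶ Y} (_ : φ = ψ) (e₁ : (⊤ : W.Opens) ≤ φ ⁻¹ᵁ (ι' ''ᵁ ⊤)) (e₂ : (⊤ : W.Opens) ≤ ψ ⁻¹ᵁ (ι' ''ᵁ ⊤)),
        φ.appLE (ι' ''ᵁ ⊤) ⊤ e₁ = ψ.appLE (ι' ''ᵁ ⊤) ⊤ e₂ := by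
      intro φ ψ h e₁ e₂
      subst h
      rfl
    exact hcongr hcomm _ _
  rw [key]

/-- The two-chart formula for `K = K₀~` on an affine `X`: the ideal is the contraction `(K₀·Γ(W)) ∩ Γ(X′)` along `j′♯ : Γ(X′) → Γ(W)`. [cite: GortzWedhorn2020, Prop. 13.91 (2)] -/
theorem comap_map_ofIdealTop_of_charts {Y X X' W : Scheme.{u}} [IsAffine X] [IsAffine X'] [IsAffine W]
    (ι : X ⟶ Y) [IsOpenImmersion ι] [QuasiCompact ι] (ι' : X' ⟶ Y) [IsOpenImmersion ι']
    (j : W ⟶ X) [IsOpenImmersion j] (j' : W ⟶ X') (hcomm : j ≫ ι = j' ≫ ι')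
    (hj : j.opensRange = ι ⁻¹ᵁ ι'.opensRange) (K₀ : Ideal Γ(X, ⊤)) :
    ((ofIdealTop K₀).map ι).comap ι' = ofIdealTop ((K₀.map j.appTop.hom).comap j'.appTop.hom) := by
  rw [comap_map_eq_ofIdealTop_of_charts ι ι' j j' hcomm hj, Literature.AlgebraicGeometry.Resolution.comap_ofIdealTop_of_isAffine,
    Literature.AlgebraicGeometry.Resolution.ideal_ofIdealTop_top]

/-- ★★ **The two-chart formula, `Spec` form.** Charts `ι : Spec B → Y`, `ι′ : Spec B′ → Y` with overlap chart `Spec C` and overlap ring maps `τ : B → C`, `τ′ : B′ → C`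
(`Spec τ ≫ ι = Spec τ′ ≫ ι′`, `Spec τ` an open immersion onto `ι⁻¹ ι′(Spec B′)`): `((K₀~).map ι).comap ι′ = ((K₀.map τ).comap τ′)~` — the restriction to the second
chart of the largest extension of `K₀~` is the ideal sheaf of `(K₀·C) ∩ B′`. [cite: GortzWedhorn2020, Prop. 13.91 (2)] [cite: StacksProject, Tag 01HQ] -/
theorem comap_map_idealSheaf_of_charts {Y : Scheme.{u}} {B B' C : Type u} [CommRing B] [CommRing B'] [CommRing C]
    (ι : Spec (.of B) ⟶ Y) [IsOpenImmersion ι] [QuasiCompact ι] (ι' : Spec (.of B') ⟶ Y) [IsOpenImmersion ι']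
    (τ : B →+* C) (τ' : B' →+* C) [IsOpenImmersion (Spec.map (CommRingCat.ofHom τ))]
    (hcomm : Spec.map (CommRingCat.ofHom τ) ≫ ι = Spec.map (CommRingCat.ofHom τ') ≫ ι')
    (hj : (Spec.map (CommRingCat.ofHom τ)).opensRange = ι ⁻¹ᵁ ι'.opensRange) (K₀ : Ideal B) :
    ((affineBlowup.idealSheaf K₀).map ι).comap ι' = affineBlowup.idealSheaf ((K₀.map τ).comap τ') := by
  rw [comap_map_eq_ofIdealTop_of_charts ι ι' _ _ hcomm hj]
  have h1 : (affineBlowup.idealSheaf K₀).comap (Spec.map (CommRingCat.ofHom τ)) = affineBlowup.idealSheaf (K₀.map τ) :=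
    Literature.AlgebraicGeometry.Resolution.comap_ofIdealTop_SpecMap τ K₀
  rw [h1, affineBlowup.idealSheaf_ideal_top]
  change ofIdealTop (((K₀.map τ).map (Scheme.ΓSpecIso (.of C)).inv.hom).comap (Spec.map (CommRingCat.ofHom τ')).appTop.hom) =
    ofIdealTop (((K₀.map τ).comap τ').map (Scheme.ΓSpecIso (.of B')).inv.hom)
  congr 1
  -- `Γ`-`Spec` naturality: `(Spec τ′)♯ ∘ ΓSpecIso_{B′}⁻¹ = ΓSpecIso_C⁻¹ ∘ τ′`
  have hnat : CommRingCat.ofHom τ' ≫ (Scheme.ΓSpecIso (.of C)).inv = (Scheme.ΓSpecIso (.of B')).inv ≫ (Spec.map (CommRingCat.ofHom τ')).appTop :=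
    Scheme.ΓSpecIso_inv_naturality (CommRingCat.ofHom τ')
  -- both sides as comaps along `ΓSpecIso_{B′}.hom`
  have hR : ((K₀.map τ).comap τ').map (Scheme.ΓSpecIso (.of B')).inv.hom = ((K₀.map τ).comap τ').comap (Scheme.ΓSpecIso (.of B')).hom.hom := by
    have := Ideal.map_comap_of_equiv (I := (K₀.map τ).comap τ') (Scheme.ΓSpecIso (.of B')).symm.commRingCatIsoToRingEquiv
    exact this
  have hL : ((K₀.map τ).map (Scheme.ΓSpecIso (.of C)).inv.hom) = (K₀.map τ).comap (Scheme.ΓSpecIso (.of C)).hom.hom := by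
    have := Ideal.map_comap_of_equiv (I := K₀.map τ) (Scheme.ΓSpecIso (.of C)).symm.commRingCatIsoToRingEquiv
    exact this
  rw [hR, hL, Ideal.comap_comap, Ideal.comap_comap]
  congr 1
  -- ring maps: `ΓC.hom ∘ (Spec τ′)♯ = τ′ ∘ ΓB′.hom`
  have h5 : (Spec.map (CommRingCat.ofHom τ')).appTop =
      (Scheme.ΓSpecIso (.of B')).hom ≫ CommRingCat.ofHom τ' ≫ (Scheme.ΓSpecIso (.of C)).inv := by
    rw [hnat, Iso.hom_inv_id_assoc]
  have h3 : (Spec.map (CommRingCat.ofHom τ')).appTop ≫ (Scheme.ΓSpecIso (.of C)).hom = (Scheme.ΓSpecIso (.of B')).hom ≫ CommRingCat.ofHom τ' := by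
    rw [h5, Category.assoc, Category.assoc, Iso.inv_hom_id, Category.comp_id]
  have h4 := congrArg (fun f => CommRingCat.Hom.hom f) h3
  simp only [CommRingCat.hom_comp, CommRingCat.hom_ofHom] at h4
  exact h4

end Summit.ResolutionOfSingularities.ResolutionOfSingularities.Theorems.FInjectiveMacaulayfication.FHalfRowOfTwoStoreys

end
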